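import Summits.PneNP.PneNP.Theses.KarlinRubin
import Summits.PneNP.PneNP.Theorems.KarlinRubinMonotoneBlindStubWeakBlindDnfCount

/-!
# Crux `MonotoneBlind` (stmt-PneNP-18027, route KarlinRubin), line `Sketch`: stub `stub_advIdentity`

The DEAD–REVIVAL identity, the starting point of the minimal-completion framework (wave-2 rungs) of line
`Sketch` of crux stmt-PneNP-18027. For a MONOTONE test `f : EdgeVec n → Bool` (pointwise order on
`EdgeVec n`, `false < true`) and every `n k`:

  `Pr_{G(n,1/2,k)}[f = 1] = Pr_{G(n,1/2)}[f = 1] + (#kSubsets)⁻¹ Σ_{A ∈ kSubsets} Pr_x[f x = 0 ∧ f (plant A x) = 1]`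

(planted acceptance `=` null acceptance `+` ADVANTAGE, the advantage being the mass of DEAD noises REVIVED by
the planted clique) — `stub_advIdentity`.

Proof. Fibre the planted law over the planted set `A` (`plantedCliqueDist_toOuterMeasure_eq_sum`). For each `A`
the event `{x | f (plant A x) = 1}` is the DISJOINT union of `{f = 1}` (as `x ≤ plant A x`, `le_plant`, and `f`
is monotone) and the revival event `{f x = 0 ∧ f (plant A x) = 1}`, and the outer measure of a `PMF` is additive
on disjoint sets (`PMF.toOuterMeasure_apply`, `Set.indicator_union_of_disjoint`) —
`erdosRenyiHalf_plant_accept_eq_add`; then average over `A`.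

Helpers for the framework (ARBITRARY test `f`, no monotonicity):

* `sum_card_filter_dead_revived_eq` — the advantage count swapped:
  `Σ_A #{x : f x = 0, f (plant A x) = 1} = Σ_{x : f x = 0} #{A : f (plant A x) = 1}`;
* `adv_eq_sum_card_div` — the advantage as `(#kSubsets)⁻¹ · (Σ_{x dead} #{A : revived}) / #EdgeVec`;
* `card_filter_plant_accept_mul_pow_le_of_cover` — **cover bound at a dead noise, general form**: if a family
  `𝓔` of sets of slots OFF in `x` with `∅ ∉ 𝓔` (so the DNF `f_𝓔` is dead at `x`) COVERS the revivals of `x`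
  (`f (plant A x) = 1 →` some `E ∈ 𝓔` lies inside `plant A x`), then for every `m`
  (`d = min k n`, `Min` = inclusion-minimal members of `{V(E) | E ∈ 𝓔}`):
  `#{A : f (plant A x) = 1} · n^{m+2} ≤ #kSubsets · (d² nᵐ · #{U ∈ Min : |U| ≤ m+1} + d^{m+2} · #𝓔)` —
  the landed DNF count `card_filter_plant_exists_mul_pow_le`;
* `card_filter_plant_accept_mul_pow_le` — the same with `𝓔 := 𝓜(x)`, the MINIMAL COMPLETIONS of `f` at a
  dead noise `x` (inclusion-minimal sets `M` of off slots with `f (x ∪ M) = 1`; for monotone `f` the minterms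
  of the restriction of `f` above `x`): `plant A x = x ∪ {off slots inside A}` is a completion, so it lies
  above a minimal one, whose slots are inside `A`.

All `--supports stmt-PneNP-18027`; no definitions.
-/

set_option linter.dupNamespace false -- `Summit.PneNP.PneNP.…` is the layout-mandated namespace

namespace Summit.PneNP.PneNP.Theorems.MonotoneBlind.VertexCover

open Literature.Computability.Complexity Literature.Probability.RandomGraphs.PlantedClique Filter Finset
open scoped ENNReal Topology Classical

variable {n : ℕ}

/-! ### The acceptance split for one planted set -/

/-- **Acceptance split.** For a monotone test `f` and any planted set `A`, the event `{x | f (plant A x) = 1}`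
is the disjoint union of `{f = 1}` (`x ≤ plant A x` pointwise, `le_plant`) and the revival event
`{f x = 0 ∧ f (plant A x) = 1}`, so its `G(n,1/2)`-mass is the sum of the two masses. [folklore] -/
theorem erdosRenyiHalf_plant_accept_eq_add (A : Finset (Fin n)) {f : EdgeVec n → Bool} (hf : Monotone f) :
    (erdosRenyiHalf n).toOuterMeasure {x | plant A x ∈ {y : EdgeVec n | f y = true}} =
      (erdosRenyiHalf n).toOuterMeasure {x | f x = true} +
        (erdosRenyiHalf n).toOuterMeasure {x | f x = false ∧ f (plant A x) = true} := by
  have hset : {x | plant A x ∈ {y : EdgeVec n | f y = true}} =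
      {x : EdgeVec n | f x = true} ∪ {x | f x = false ∧ f (plant A x) = true} := by
    ext x
    simp only [Set.mem_setOf_eq, Set.mem_union]
    constructor
    · intro hx
      cases hfx : f x
      · exact Or.inr ⟨rfl, hx⟩
      · exact Or.inl rfl
    · rintro (hx | ⟨-, hx⟩)
      · have hle : x ≤ plant A x := fun e => le_plant A x e
        exact Bool.le_iff_imp.1 (hf hle) hx
      · exact hx
  have hdisj : Disjoint {x : EdgeVec n | f x = true} {x | f x = false ∧ f (plant A x) = true} := by
    rw [Set.disjoint_left]
    rintro x hx ⟨hx', -⟩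
    rw [Set.mem_setOf_eq] at hx
    rw [hx] at hx'
    exact Bool.noConfusion hx'
  rw [hset, PMF.toOuterMeasure_apply, PMF.toOuterMeasure_apply, PMF.toOuterMeasure_apply, ← ENNReal.tsum_add,
    Set.indicator_union_of_disjoint hdisj]

/-! ### The dead–revival identity -/

/-- **stub_advIdentity** (the dead–revival identity). For every `n k` and every MONOTONE test `f`
(pointwise order on `EdgeVec n`, `false < true`): planted acceptance `=` null acceptance `+`
`(#kSubsets)⁻¹ Σ_{A ∈ kSubsets} Pr_{G(n,1/2)}[f x = false ∧ f (plant A x) = true]`. Proof: fibre the planted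
law over `A` (`plantedCliqueDist_toOuterMeasure_eq_sum`), split each fibre
(`erdosRenyiHalf_plant_accept_eq_add`) and average (`(#kSubsets)⁻¹ · #kSubsets = 1`). [folklore] -/
theorem stub_advIdentity :
    ∀ (n k : ℕ) (f : EdgeVec n → Bool), Monotone f →
      (plantedCliqueDist n k).toOuterMeasure {y | f y = true} =
        (erdosRenyiHalf n).toOuterMeasure {x | f x = true} +
          ((#(kSubsets n k) : ℕ) : ℝ≥0∞)⁻¹ *
            ∑ A ∈ kSubsets n k, (erdosRenyiHalf n).toOuterMeasure {x | f x = false ∧ f (plant A x) = true} := by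
  intro n k f hf
  have hne := card_kSubsets_cast_ne_zero n k
  have htop : ((#(kSubsets n k) : ℕ) : ℝ≥0∞) ≠ ⊤ := ENNReal.natCast_ne_top _
  rw [plantedCliqueDist_toOuterMeasure_eq_sum,
    sum_congr rfl fun A _ => erdosRenyiHalf_plant_accept_eq_add A hf, sum_add_distrib, sum_const,
    nsmul_eq_mul, mul_add, ← mul_assoc, ENNReal.inv_mul_cancel hne htop, one_mul]

/-! ### The advantage, fibred over the noise -/

/-- **The advantage count, swapped.** For any test `f`:
`Σ_{A ∈ kSubsets} #{x : f x = 0, f (plant A x) = 1} = Σ_{x : f x = 0} #{A ∈ kSubsets : f (plant A x) = 1}`.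
[folklore] -/
theorem sum_card_filter_dead_revived_eq (k : ℕ) (f : EdgeVec n → Bool) :
    ∑ A ∈ kSubsets n k, #(univ.filter fun x : EdgeVec n => f x = false ∧ f (plant A x) = true) =
      ∑ x ∈ univ.filter (fun x : EdgeVec n => f x = false),
        #((kSubsets n k).filter fun A => f (plant A x) = true) := by
  simp only [card_filter]
  rw [sum_comm, sum_filter]
  refine sum_congr rfl fun x _ => ?_
  split_ifs with hx
  · exact sum_congr rfl fun A _ => if_congr (and_iff_right hx) rfl rfl
  · exact sum_eq_zero fun A _ => if_neg fun h => hx h.1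

/-- **The advantage in counting form.** For any test `f`:
`(#kSubsets)⁻¹ Σ_A Pr_{G(n,1/2)}[f x = 0 ∧ f (plant A x) = 1] =
(#kSubsets)⁻¹ · (Σ_{x : f x = 0} #{A ∈ kSubsets : f (plant A x) = 1}) / #EdgeVec`. [folklore] -/
theorem adv_eq_sum_card_div (k : ℕ) (f : EdgeVec n → Bool) :
    ((#(kSubsets n k) : ℕ) : ℝ≥0∞)⁻¹ *
        ∑ A ∈ kSubsets n k, (erdosRenyiHalf n).toOuterMeasure {x | f x = false ∧ f (plant A x) = true} =
      ((#(kSubsets n k) : ℕ) : ℝ≥0∞)⁻¹ *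
        (((∑ x ∈ univ.filter (fun x : EdgeVec n => f x = false),
            #((kSubsets n k).filter fun A => f (plant A x) = true) : ℕ) : ℝ≥0∞) /
          (Fintype.card (EdgeVec n) : ℝ≥0∞)) := by
  congr 1
  rw [← sum_card_filter_dead_revived_eq, Nat.cast_sum, div_eq_mul_inv, sum_mul]
  refine sum_congr rfl fun A _ => ?_
  rw [erdosRenyiHalf_toOuterMeasure_eq_card_div, div_eq_mul_inv]
  simp only [Set.mem_setOf_eq]

/-! ### The cover bound at a dead noise -/

/-- **Cover bound at a dead noise, general form** (arbitrary test `f`). Let `x` be a noise and `𝓔` a family of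
sets of slots, all OFF in `x` (`hoff`), with no member inside `x` (`hdead`; given `hoff` this says `∅ ∉ 𝓔`),
which COVERS the revivals of `x`: whenever `f (plant A x) = 1` some `E ∈ 𝓔` lies inside `plant A x`
(`hcover`). Then for every `m` (`d = min k n`, `Min` the inclusion-minimal members of `{V(E) | E ∈ 𝓔}`):
`#{A : f (plant A x) = 1} · n^{m+2} ≤ #kSubsets · (d² nᵐ · #{U ∈ Min : |U| ≤ m+1} + d^{m+2} · #𝓔)` — the
landed DNF count `card_filter_plant_exists_mul_pow_le` for the term family `𝓔` (dead at `x`, `E ∖ x = E`).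
[folklore] -/
theorem card_filter_plant_accept_mul_pow_le_of_cover (k m : ℕ) (f : EdgeVec n → Bool) (x : EdgeVec n)
    (𝓔 : Finset (Finset (⊤ : SimpleGraph (Fin n)).edgeSet))
    (hoff : ∀ E ∈ 𝓔, ∀ e ∈ E, x e = false)
    (hdead : ¬ ∃ E ∈ 𝓔, ∀ e ∈ E, x e = true)
    (hcover : ∀ A ∈ kSubsets n k, f (plant A x) = true → ∃ E ∈ 𝓔, ∀ e ∈ E, plant A x e = true) :
    #((kSubsets n k).filter fun A => f (plant A x) = true) * n ^ (m + 2) ≤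
      #(kSubsets n k) *
        ((min k n) ^ 2 * n ^ m *
            #((Razborov.minimals (𝓔.image fun E => univ.filter fun v : Fin n =>
                ∃ e : (⊤ : SimpleGraph (Fin n)).edgeSet, e ∈ E ∧ v ∈ (e : Sym2 (Fin n)))).filter
              fun U => #U ≤ m + 1) +
          (min k n) ^ (m + 2) * #𝓔) := by
  -- for `E ∈ 𝓔` the missing part `E ∖ x` is all of `E`
  have himage : (𝓔.image fun E => univ.filter fun v : Fin n =>
        ∃ e : (⊤ : SimpleGraph (Fin n)).edgeSet, e ∈ E.filter (fun e => x e = false) ∧ v ∈ (e : Sym2 (Fin n))) =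
      𝓔.image fun E => univ.filter fun v : Fin n =>
        ∃ e : (⊤ : SimpleGraph (Fin n)).edgeSet, e ∈ E ∧ v ∈ (e : Sym2 (Fin n)) := by
    refine image_congr fun E hE => ?_
    rw [mem_coe] at hE
    rw [filter_true_of_mem (hoff E hE)]
  have key := card_filter_plant_exists_mul_pow_le k m 𝓔 x hdead
  rw [himage] at key
  refine le_trans (Nat.mul_le_mul_right _ (card_le_card fun A hA => ?_)) key
  rw [mem_filter] at hA ⊢
  exact ⟨hA.1, hcover A hA.1 hA.2⟩

/-- **Cover bound at a dead noise by minimal completions** (arbitrary test `f`). At a dead noise `x`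
(`f x = 0`) let `𝓜(x)` be the MINIMAL COMPLETIONS of `f` at `x` — the inclusion-minimal sets `M` of slots off
in `x` with `f (x ∪ M) = 1` (`x ∪ M := fun e => x e || decide (e ∈ M)`; for monotone `f` these are the minterms
of the restriction of `f` above `x`) — and `Min(x)` the inclusion-minimal members of `{V(M) | M ∈ 𝓜(x)}`. Then
for every `m` (`d = min k n`):
`#{A : f (plant A x) = 1} · n^{m+2} ≤ #kSubsets · (d² nᵐ · #{U ∈ Min(x) : |U| ≤ m+1} + d^{m+2} · #𝓜(x))`,
i.e. `Pr_A[A revives x] ≤ (d/n)² · #{U ∈ Min(x) : |U| ≤ m+1} + (d/n)^{m+2} · #𝓜(x)`: the revivals are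
covered by `𝓜(x)` since `plant A x = x ∪ {off slots inside A}` is a completion and lies above a minimal one,
all of whose slots are inside `A` (`Razborov.exists_minimal_subset`); `𝓜(x)` is dead at `x` as `f x = 0`
forbids the empty completion. [folklore] -/
theorem card_filter_plant_accept_mul_pow_le (k m : ℕ) (f : EdgeVec n → Bool) (x : EdgeVec n)
    (hx : f x = false) :
    #((kSubsets n k).filter fun A => f (plant A x) = true) * n ^ (m + 2) ≤
      #(kSubsets n k) *
        ((min k n) ^ 2 * n ^ m *
            #((Razborov.minimals
                ((Razborov.minimals (univ.filter fun M : Finset (⊤ : SimpleGraph (Fin n)).edgeSet =>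
                    (∀ e ∈ M, x e = false) ∧ f (fun e => x e || decide (e ∈ M)) = true)).image
                  fun M => univ.filter fun v : Fin n =>
                    ∃ e : (⊤ : SimpleGraph (Fin n)).edgeSet, e ∈ M ∧ v ∈ (e : Sym2 (Fin n)))).filter
              fun U => #U ≤ m + 1) +
          (min k n) ^ (m + 2) *
            #(Razborov.minimals (univ.filter fun M : Finset (⊤ : SimpleGraph (Fin n)).edgeSet =>
                (∀ e ∈ M, x e = false) ∧ f (fun e => x e || decide (e ∈ M)) = true))) := by
  -- members of `𝓜(x)` are sets of off slots completing `f` at `x`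
  have hmem : ∀ M ∈ Razborov.minimals (univ.filter fun M : Finset (⊤ : SimpleGraph (Fin n)).edgeSet =>
      (∀ e ∈ M, x e = false) ∧ f (fun e => x e || decide (e ∈ M)) = true),
      (∀ e ∈ M, x e = false) ∧ f (fun e => x e || decide (e ∈ M)) = true := fun M hM =>
    (mem_filter.1 (Razborov.minimals_subset _ hM)).2
  refine card_filter_plant_accept_mul_pow_le_of_cover k m f x _ (fun M hM => (hmem M hM).1) ?_ ?_
  · -- `𝓜(x)` is dead at `x`: a member inside `x` is empty, and `∅` is not a completion as `f x = 0`
    rintro ⟨E, hE, hEx⟩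
    obtain ⟨hoff, hfE⟩ := hmem E hE
    have hExx : (fun e => x e || decide (e ∈ E)) = x := by
      funext e
      by_cases he : e ∈ E
      · exact absurd ((hoff e he).symm.trans (hEx e he)) Bool.false_ne_true
      · rw [decide_eq_false he, Bool.or_false]
    rw [hExx, hx] at hfE
    exact Bool.false_ne_true hfE
  · -- cover: `plant A x = x ∪ W`, `W` the off slots inside `A`, is a completion above a minimal one
    intro A _ hA
    set W := univ.filter fun e : (⊤ : SimpleGraph (Fin n)).edgeSet =>
      x e = false ∧ ∀ v ∈ (e : Sym2 (Fin n)), v ∈ A with hW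
    have hWx : (fun e => x e || decide (e ∈ W)) = plant A x := by
      funext e
      cases hxe : x e
      · rw [Bool.false_or]
        by_cases h : ∀ v ∈ (e : Sym2 (Fin n)), v ∈ A
        · rw [(plant_apply_eq_true_iff A x e).2 (Or.inr h)]
          exact decide_eq_true (mem_filter.2 ⟨mem_univ _, hxe, h⟩)
        · have hp : plant A x e ≠ true := fun hp => by
            rcases (plant_apply_eq_true_iff A x e).1 hp with h' | h'
            · rw [hxe] at h'
              exact Bool.false_ne_true h'
            · exact h h'
          rw [eq_false_of_ne_true hp]
          exact decide_eq_false fun h' => h (mem_filter.1 h').2.2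
      · rw [Bool.true_or]
        exact ((plant_apply_eq_true_iff A x e).2 (Or.inl hxe)).symm
    have hWmem : W ∈ univ.filter fun M : Finset (⊤ : SimpleGraph (Fin n)).edgeSet =>
        (∀ e ∈ M, x e = false) ∧ f (fun e => x e || decide (e ∈ M)) = true := by
      refine mem_filter.2 ⟨mem_univ _, fun e he => (mem_filter.1 he).2.1, ?_⟩
      rw [hWx]
      exact hA
    obtain ⟨M, hM, hMW⟩ := Razborov.exists_minimal_subset hWmem
    exact ⟨M, hM, fun e he => (plant_apply_eq_true_iff A x e).2 (Or.inr (mem_filter.1 (hMW he)).2.2)⟩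

end Summit.PneNP.PneNP.Theorems.MonotoneBlind.VertexCover
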